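import Literature.AlgebraicGeometry.HodgeTheory.BettiHodgeConjectureProductsTotalHodgeMorphismsAlgebraic
import HarnessLib

/-!
# Joint-action criteria relative to a set of Künneth pieces: if the pieces of `H^{2c}(Y × Z)` outside a set `P` carry only algebraic Hodge classes, then ALL Hodge classes of `H^{2c}(Y × Z)` are algebraic
# iff every family `(t_p)_{p ∈ P}` of Hodge classes — equivalently every family `(φ_p ∈ Hom_HS(H^{2n−j_p}(Z), H^{i_p}(Y)(c − n)))_{p ∈ P}` — is jointly induced by ONE rational algebraic class
# (Voisin I §11.3.3 Thm. 11.38–11.40, Lemma 11.41, pp. 285–287; §7.3.1 Def. 7.22, §7.3.2; Voisin 2025 §3.2.1; Fulton §16.1)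

Family `hodge`, lane `lit-hodgefound` (Track 2 foundations library; Layers A1/A4), layer `Literature/AlgebraicGeometry/HodgeTheory`.  THEOREMS ONLY (no definition, no named fact, no instance;
D-0026 net debt `0`).  The seat's g31-#5 proved the ISOLATION-FREE criterion (families over ALL Künneth pieces of `H^{2c}`); the g30 criteria isolated ONE piece by assuming every other piece free
(`…_of_forall_ne`).  This file interpolates: for an arbitrary set `P` of pieces (a predicate on the `Z`-degree `j`; the `Y`-degree is `2c − j`) whose COMPLEMENT consists of free pieces (their Hodge
classes have algebraic cross products — e.g. the edge pieces `H⁰(Y) ⊗ H^{2c}(Z)`, `H^{2c}(Y) ⊗ H⁰(Z)` under `HC(Z)`, `HC(Y)`, the divisor-type pieces `H¹ ⊗ H^{2c−1}`, `H^{2m−1} ⊗ H¹`, the pieces reduced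
by hard Lefschetz to already-settled ones), the Hodge classes of `H^{2c}(Y × Z)` are all algebraic iff the families of Hodge classes (resp. of morphisms of Hodge structures, g31-#2) indexed by `P`
are jointly induced by one rational algebraic class.  The proof: the algebraic class `γ` provided for the `P`-part of the Künneth family `(t_{ij})` of a Hodge class `v` has `P`-components `t_p`
(faithfulness piece by piece, g30-#2) and Hodge components elsewhere, so `v − γ` is a sum of cross products of Hodge classes of FREE pieces.  The seat's g31-#7 reads it on `S × T` and `T × T'`.

WHAT IS PROVED (`μ` any orientation family in §1; complex orientations in §2).
* §1 **`BettiUniverse.forall_hodgeClasses_algebraic_of_joint_corrAction`** (free complement + joint `P`-criterion on Hodge families ⇒ every Hodge class of `H^{2c}(Y × Z)` is algebraic),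
  **`BettiUniverse.forall_hodgeClasses_algebraic_iff_joint_corrAction`** (⟺, the converse holding for all `Y`, `Z`, `P`).
* §2 **`BettiUniverse.joint_corrAction_iff_joint_hom_tateTwist_int`** (for fixed `c`, `P`: the joint criterion on Hodge families ⟺ the joint criterion on families of morphisms
  `φ_p ∈ Hom_HS(Hᵃ(Z), Hⁱ(Y)(r))`, `n + r = c`), **`BettiUniverse.forall_hodgeClasses_algebraic_iff_joint_hom_tateTwist_int`** (free complement ⇒ [all Hodge classes of `H^{2c}(Y × Z)` algebraic ⟺
  every `P`-family of morphisms of Hodge structures is jointly induced by one rational algebraic class]).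

THE PRINTS.  C. Voisin (2002) [VoisinHodgeI2002] §11.3.3 Thm. 11.38, Thm. 11.40, Lemma 11.41 and pp. 285–287; §7.3.1 Def. 7.22, §7.3.2.  C. Voisin (2025) [Voisin2025] §3.2.1 (12)–(14), Prop. 3.8, Cor. 3.9.
W. Fulton (1998) [Fulton1998] §16.1 Def. 16.1.2.  P. Deligne (2000/2006) [Deligne2000] §1.

THE OBJECTS (all the tree's).  `BettiUniverse.KunnethSrc`, `BettiUniverse.kunnethMap`, `BettiUniverse.crossMap`, `BettiUniverse.kunnethSummand`, `BettiUniverse.hodge`, `corrAction`, `HodgeStructure.Hom`, `tateTwist`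
(by `r : ℤ`), `cast`, `hodgeClasses`, `ofRatClass`, `algebraicClasses`; `BettiUniverse.exists_eq_kunnethMap_of_mem_hodgeClasses`, `BettiUniverse.kunnethMap_apply`, `BettiUniverse.kunnethMap_mem_hodgeClasses_iff`,
`BettiUniverse.mem_hodgeClasses_hodge_tensor_of_mem_algebraicClasses`, `ComplexPoints.subsingleton_singularCohomology_of_lt`; the seat's g31-#5 `BettiUniverse.corrAction_kunnethMap_eq`, g30-#2
`BettiUniverse.corrAction_crossMap_injective`, g30-#13 `BettiUniverse.span_range_ofRatClass_eq_top`, g31-#2 `…exists_hom_tateTwist_int_of_mem_hodgeClasses_kunnethSummand`,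
`…exists_mem_hodgeClasses_corrAction_crossMap_eq_ofRatClass_hom_int`.

DEVIATIONS / SCOPE.  The set of pieces is a predicate on the `Z`-degree `j` (`i = 2c − j`).  No definitions.

## References
* [VoisinHodgeI2002] C. Voisin, *Hodge Theory and Complex Algebraic Geometry I* (2002) — §7.3.1 Def. 7.22; §7.3.2; §11.3.3 Thm. 11.38–11.40, Lemma 11.41, pp. 285–287.
* [Voisin2025] C. Voisin, *Cycle classes on algebraic varieties* (2025) — §3.2.1 (12)–(14), Prop. 3.8, Cor. 3.9.
* [Fulton1998] W. Fulton, *Intersection Theory* (2nd ed., 1998) — §16.1 Def. 16.1.2.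
* [Deligne2000] P. Deligne, *The Hodge conjecture* (Clay problem description) — §1.

## Provenance
Lane `lit-hodgefound` (Hodge path, Track 2), prover seat `lit-hodgefound-p29` (generation 31), self-proposed row g31-#6 (joint-action criteria relative to a set of pieces; g31-#5 + g30-#2 + g31-#2).
-/

noncomputable section

open scoped TensorProduct
open CategoryTheory MonoidalCategory CartesianMonoidalCategory Module Finset
open Literature.AlgebraicTopology.SingularHomology
open Literature.Geometry.Kaehler

namespace Literature.AlgebraicGeometry.HodgeTheory

open Literature.AlgebraicGeometry.Motives
open Literature.AlgebraicGeometry.Motives.HodgeStructure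

variable {m n d : ℕ} {Y Z : SchemeOver ℂ}

/-- A tensor product with a trivial right factor is trivial (the Künneth summands `Hⁱ(Y) ⊗ Hʲ(Z)` with `j > 2 dim Z`). [folklore] -/
private theorem kunnethSummand_eq_zero_of_subsingleton_right {M N : Type} [AddCommGroup M] [Module ℚ M] [AddCommGroup N] [Module ℚ N] [Subsingleton N] (x : M ⊗[ℚ] N) : x = 0 := by
  induction x using TensorProduct.induction_on with
  | zero => rfl
  | tmul a b => rw [Subsingleton.elim b 0, TensorProduct.tmul_zero]
  | add x y hx hy => rw [hx, hy, add_zero]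

section Joint

variable [HodgeTensorFacts.{0, 0}] (μ : OrientationFamily)

/-! ### §1 The joint criterion on Hodge families, relative to a set of pieces with free complement -/

/-- **Free complement + joint criterion on `P` ⇒ all Hodge classes of `H^{2c}(Y × Z)` are algebraic.**  Let `P` be a set of `Z`-degrees `j` (pieces `H^{2c−j}(Y) ⊗ Hʲ(Z)`), suppose the Hodge classes
of every piece with `j ∉ P` have algebraic cross products, and suppose that for every family `(t_{ij})` of Hodge classes of the Künneth summands of `H^{2c}` there is a rational class `γ` with `γ ⊗ 1`
algebraic acting on `H^{2n−j}(Z;ℂ)` as `crossMap t_{ij} ⊗ 1` for every `j ∈ P`.  Then every Hodge class `v` of `H^{2c}(Y × Z)` has `v ⊗ 1` algebraic: with `(t_{ij})` the Künneth family of `v`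
and `(s_{ij})` that of `γ` (a Hodge class, being algebraic), `s_{ij} = t_{ij}` for `j ∈ P` (each piece acts faithfully on its `H^{2n−j}(Z;ℂ)`, the others by zero), so `v − γ = Σ_{j ∉ P} crossMap(t_{ij} − s_{ij})`
is a sum of algebraic classes. [cite: VoisinHodgeI2002, §11.3.3 Thm. 11.38–11.40, Lemma 11.41 and pp. 285–287] [cite: Voisin2025, §3.2.1 (12)–(14), Prop. 3.8 and Cor. 3.9] [cite: Fulton1998, §16.1 Def. 16.1.2] -/
theorem BettiUniverse.forall_hodgeClasses_algebraic_of_joint_corrAction (hHD : exists_isReal_hodgeModel) (hY : IsSmoothProjective m Y) (hZ : IsSmoothProjective n Z) (hYZ : IsSmoothProjective d (Y ⊗ Z))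
    {c : ℕ} (P : ℕ → Prop)
    (hfree : ∀ (i j : ℕ) (hij : i + j = 2 * c), ¬ P j → ∀ u ∈ (BettiUniverse.kunnethSummand hHD hY hZ (2 * c) ⟨(i, j), HasAntidiagonal.mem_antidiagonal.2 hij⟩).hodgeClasses c,
      ofRatClass (ComplexPoints (Y ⊗ Z)) (2 * c) (BettiUniverse.crossMap Y Z hij u) ∈ algebraicClasses (Y ⊗ Z) c)
    (hjoint : ∀ t : BettiUniverse.KunnethSrc Y Z (2 * c), (∀ ij, t ij ∈ (BettiUniverse.kunnethSummand hHD hY hZ (2 * c) ij).hodgeClasses c) →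
      ∃ γ : bettiCohomology (Y ⊗ Z) (2 * c), ofRatClass (ComplexPoints (Y ⊗ Z)) (2 * c) γ ∈ algebraicClasses (Y ⊗ Z) c ∧
        ∀ (i j a : ℕ) (hij : i + j = 2 * c) (_haj : a + j = 2 * n) (hab : a + 2 * c = i + 2 * n), P j →
          corrAction μ hY hZ hab (ofRatClass (ComplexPoints (Y ⊗ Z)) (2 * c) γ) =
            corrAction μ hY hZ hab (ofRatClass (ComplexPoints (Y ⊗ Z)) (2 * c) (BettiUniverse.crossMap Y Z hij (t ⟨(i, j), HasAntidiagonal.mem_antidiagonal.2 hij⟩)))) :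
    ∀ v ∈ (BettiUniverse.hodge hHD hYZ (2 * c)).hodgeClasses c, ofRatClass (ComplexPoints (Y ⊗ Z)) (2 * c) v ∈ algebraicClasses (Y ⊗ Z) c := by
  classical
  have hI := hodgePQ_independent_of_hodgeModel_holds
  intro v hv
  obtain ⟨t, ⟨ht, hvsum⟩, -⟩ := BettiUniverse.exists_eq_kunnethMap_of_mem_hodgeClasses hHD hI hY hZ hYZ (2 * c) c hv
  obtain ⟨γ, hγ, hact⟩ := hjoint t ht
  -- the Künneth family of the (Hodge, being algebraic) class `γ`
  obtain ⟨s, ⟨hs, hγsum⟩, -⟩ := BettiUniverse.exists_eq_kunnethMap_of_mem_hodgeClasses hHD hI hY hZ (hY.tensor_holds hZ) (2 * c) c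
    (BettiUniverse.mem_hodgeClasses_hodge_tensor_of_mem_algebraicClasses hHD hY hZ hγ)
  -- `v − γ = Σ crossMap (t − s)` is algebraic term by term
  have hdiff : v - γ = ∑ ij : ↥(antidiagonal (2 * c)), BettiUniverse.crossMap Y Z (mem_antidiagonal.1 ij.2) (t ij - s ij) := by
    rw [hvsum, hγsum, ← Finset.sum_sub_distrib]
    exact Finset.sum_congr rfl fun ij _ ↦ (map_sub _ _ _).symm
  have halg : ofRatClass (ComplexPoints (Y ⊗ Z)) (2 * c) (v - γ) ∈ algebraicClasses (Y ⊗ Z) c := by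
    rw [hdiff, map_sum]
    refine Submodule.sum_mem _ fun ij _ ↦ ?_
    obtain ⟨⟨i, j⟩, hij2⟩ := ij
    have hij : i + j = 2 * c := mem_antidiagonal.1 hij2
    by_cases hP : P j
    · -- a `P`-piece: `s_{ij} = t_{ij}` by faithfulness (or the summand vanishes, `j > 2n`)
      have e : t ⟨(i, j), hij2⟩ - s ⟨(i, j), hij2⟩ = 0 := by
        by_cases hj : j ≤ 2 * n
        · refine sub_eq_zero.2 (BettiUniverse.corrAction_crossMap_injective μ hY hZ hij (show (2 * n - j) + j = 2 * n by omega) (show (2 * n - j) + 2 * c = i + 2 * n by omega) ?_)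
          change corrAction μ hY hZ _ (ofRatClass (ComplexPoints (Y ⊗ Z)) (2 * c) (BettiUniverse.crossMap Y Z hij (t ⟨(i, j), hij2⟩))) =
            corrAction μ hY hZ _ (ofRatClass (ComplexPoints (Y ⊗ Z)) (2 * c) (BettiUniverse.crossMap Y Z hij (s ⟨(i, j), hij2⟩)))
          rw [← hact i j (2 * n - j) hij (by omega) (by omega) hP, hγsum, BettiUniverse.corrAction_kunnethMap_eq μ hY hZ hij (show (2 * n - j) + 2 * c = i + 2 * n by omega) s]
        · haveI : Subsingleton (bettiCohomology Z j) := ComplexPoints.subsingleton_singularCohomology_of_lt hZ ℚ (show 2 * n < j by omega)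
          exact kunnethSummand_eq_zero_of_subsingleton_right _
      change ofRatClass (ComplexPoints (Y ⊗ Z)) (2 * c) (BettiUniverse.crossMap Y Z hij (t ⟨(i, j), hij2⟩ - s ⟨(i, j), hij2⟩)) ∈ algebraicClasses (Y ⊗ Z) c
      rw [e, map_zero, map_zero]
      exact Submodule.zero_mem _
    · exact hfree i j hij hP _ (Submodule.sub_mem _ (ht ⟨(i, j), hij2⟩) (hs ⟨(i, j), hij2⟩))
  have e : ofRatClass (ComplexPoints (Y ⊗ Z)) (2 * c) v = ofRatClass (ComplexPoints (Y ⊗ Z)) (2 * c) γ + ofRatClass (ComplexPoints (Y ⊗ Z)) (2 * c) (v - γ) := by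
    rw [map_sub, add_sub_cancel]
  rw [e]
  exact Submodule.add_mem _ hγ halg

/-- **The joint criterion relative to `P` is an equivalence** (the converse for all `Y`, `Z`, `P`: a Hodge family `(t_{ij})` has `Σ crossMap t_{ij}` a Hodge class of `H^{2c}(Y × Z)`, algebraic by hypothesis,
acting on each `H^{2n−j}(Z;ℂ)` as `crossMap t_{ij}`). [cite: VoisinHodgeI2002, §11.3.3 Thm. 11.38–11.40, Lemma 11.41 and pp. 285–287] [cite: Voisin2025, §3.2.1 (12)–(14), Prop. 3.8 and Cor. 3.9] -/
theorem BettiUniverse.forall_hodgeClasses_algebraic_iff_joint_corrAction (hHD : exists_isReal_hodgeModel) (hY : IsSmoothProjective m Y) (hZ : IsSmoothProjective n Z) (hYZ : IsSmoothProjective d (Y ⊗ Z))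
    {c : ℕ} (P : ℕ → Prop)
    (hfree : ∀ (i j : ℕ) (hij : i + j = 2 * c), ¬ P j → ∀ u ∈ (BettiUniverse.kunnethSummand hHD hY hZ (2 * c) ⟨(i, j), HasAntidiagonal.mem_antidiagonal.2 hij⟩).hodgeClasses c,
      ofRatClass (ComplexPoints (Y ⊗ Z)) (2 * c) (BettiUniverse.crossMap Y Z hij u) ∈ algebraicClasses (Y ⊗ Z) c) :
    (∀ v ∈ (BettiUniverse.hodge hHD hYZ (2 * c)).hodgeClasses c, ofRatClass (ComplexPoints (Y ⊗ Z)) (2 * c) v ∈ algebraicClasses (Y ⊗ Z) c) ↔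
      ∀ t : BettiUniverse.KunnethSrc Y Z (2 * c), (∀ ij, t ij ∈ (BettiUniverse.kunnethSummand hHD hY hZ (2 * c) ij).hodgeClasses c) →
        ∃ γ : bettiCohomology (Y ⊗ Z) (2 * c), ofRatClass (ComplexPoints (Y ⊗ Z)) (2 * c) γ ∈ algebraicClasses (Y ⊗ Z) c ∧
          ∀ (i j a : ℕ) (hij : i + j = 2 * c) (_haj : a + j = 2 * n) (hab : a + 2 * c = i + 2 * n), P j →
            corrAction μ hY hZ hab (ofRatClass (ComplexPoints (Y ⊗ Z)) (2 * c) γ) =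
              corrAction μ hY hZ hab (ofRatClass (ComplexPoints (Y ⊗ Z)) (2 * c) (BettiUniverse.crossMap Y Z hij (t ⟨(i, j), HasAntidiagonal.mem_antidiagonal.2 hij⟩))) := by
  have hI := hodgePQ_independent_of_hodgeModel_holds
  refine ⟨fun h t ht ↦ ?_, BettiUniverse.forall_hodgeClasses_algebraic_of_joint_corrAction μ hHD hY hZ hYZ P hfree⟩
  refine ⟨BettiUniverse.kunnethMap Y Z (2 * c) t, h _ ((BettiUniverse.kunnethMap_mem_hodgeClasses_iff hHD hI hY hZ hYZ (2 * c) c t).2 ht), fun i j a hij _ hab _ ↦ ?_⟩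
  rw [BettiUniverse.kunnethMap_apply, BettiUniverse.corrAction_kunnethMap_eq μ hY hZ hij hab t]

end Joint

/-! ### §2 The joint criterion on families of morphisms of Hodge structures -/

section JointHom

variable [HodgeTensorFacts.{0, 0}]

/-- **For fixed `c` and `P`, the joint criterion on Hodge families is equivalent to the joint criterion on families of morphisms of Hodge structures** `φ_{ij} ∈ Hom_HS(Hᵃ(Z), Hⁱ(Y)(r))`, `i + j = 2c`,
`a + j = 2n`, `n + r = c`, `j ∈ P` (complex orientations; g31-#2: every Hodge class of a summand is a `φ_t` and every `φ` is a `φ_t`). [cite: VoisinHodgeI2002, §7.3.1 Def. 7.22, §7.3.2, §11.3.3 Lemma 11.41 and pp. 285–287]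
[cite: Voisin2025, §3.2.1 (12)–(14), Prop. 3.8 and Cor. 3.9] -/
theorem BettiUniverse.joint_corrAction_iff_joint_hom_tateTwist_int (hHD : exists_isReal_hodgeModel) (hY : IsSmoothProjective m Y) (hZ : IsSmoothProjective n Z) {c : ℕ} (P : ℕ → Prop) :
    (∀ t : BettiUniverse.KunnethSrc Y Z (2 * c), (∀ ij, t ij ∈ (BettiUniverse.kunnethSummand hHD hY hZ (2 * c) ij).hodgeClasses c) →
        ∃ γ : bettiCohomology (Y ⊗ Z) (2 * c), ofRatClass (ComplexPoints (Y ⊗ Z)) (2 * c) γ ∈ algebraicClasses (Y ⊗ Z) c ∧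
          ∀ (i j a : ℕ) (hij : i + j = 2 * c) (_haj : a + j = 2 * n) (hab : a + 2 * c = i + 2 * n), P j →
            corrAction complexOrientationFamily hY hZ hab (ofRatClass (ComplexPoints (Y ⊗ Z)) (2 * c) γ) =
              corrAction complexOrientationFamily hY hZ hab (ofRatClass (ComplexPoints (Y ⊗ Z)) (2 * c) (BettiUniverse.crossMap Y Z hij (t ⟨(i, j), HasAntidiagonal.mem_antidiagonal.2 hij⟩)))) ↔
      ∀ Φ : ∀ (i j a : ℕ) (r : ℤ) (_hij : i + j = 2 * c) (_haj : a + j = 2 * n) (_hr : ((n : ℕ) : ℤ) + r = ((c : ℕ) : ℤ)) (hw : ((i : ℕ) : ℤ) - 2 * r = ((a : ℕ) : ℤ)), P j →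
          HodgeStructure.Hom (BettiUniverse.hodge hHD hZ a) (((BettiUniverse.hodge hHD hY i).tateTwist r).cast hw),
        ∃ γ : bettiCohomology (Y ⊗ Z) (2 * c), ofRatClass (ComplexPoints (Y ⊗ Z)) (2 * c) γ ∈ algebraicClasses (Y ⊗ Z) c ∧
          ∀ (i j a : ℕ) (r : ℤ) (hij : i + j = 2 * c) (haj : a + j = 2 * n) (hab : a + 2 * c = i + 2 * n) (hr : ((n : ℕ) : ℤ) + r = ((c : ℕ) : ℤ)) (hw : ((i : ℕ) : ℤ) - 2 * r = ((a : ℕ) : ℤ))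
            (hP : P j), ∀ v, corrAction complexOrientationFamily hY hZ hab (ofRatClass (ComplexPoints (Y ⊗ Z)) (2 * c) γ) (ofRatClass (ComplexPoints Z) a v) =
              ofRatClass (ComplexPoints Y) i ((Φ i j a r hij haj hr hw hP).toLinearMap v) := by
  classical
  constructor
  · intro h Φ
    -- the Hodge classes `t_{ij}` with `φ_{t_{ij}} = Φ_{ij}` on `P` (g31-#2 §2), `0` elsewhere
    have key : ∀ ij : ↥(antidiagonal (2 * c)), ∃ t : bettiCohomology Y ij.1.1 ⊗[ℚ] bettiCohomology Z ij.1.2,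
        t ∈ (BettiUniverse.kunnethSummand hHD hY hZ (2 * c) ij).hodgeClasses c ∧
          ∀ (hj : ij.1.2 ≤ 2 * n) (hP : P ij.1.2) (v : bettiCohomology Z (2 * n - ij.1.2)),
            corrAction complexOrientationFamily hY hZ (show (2 * n - ij.1.2) + 2 * c = ij.1.1 + 2 * n by have := mem_antidiagonal.1 ij.2; omega)
                (ofRatClass (ComplexPoints (Y ⊗ Z)) (2 * c) (BettiUniverse.crossMap Y Z (mem_antidiagonal.1 ij.2) t)) (ofRatClass (ComplexPoints Z) (2 * n - ij.1.2) v) =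
              ofRatClass (ComplexPoints Y) ij.1.1 ((Φ ij.1.1 ij.1.2 (2 * n - ij.1.2) (((c : ℕ) : ℤ) - ((n : ℕ) : ℤ)) (mem_antidiagonal.1 ij.2) (by omega) (by omega)
                (by have := mem_antidiagonal.1 ij.2; omega) hP).toLinearMap v) := by
      intro ij
      by_cases hj : ij.1.2 ≤ 2 * n ∧ P ij.1.2
      · obtain ⟨t, ht, htφ⟩ := BettiUniverse.exists_mem_hodgeClasses_corrAction_crossMap_eq_ofRatClass_hom_int hHD hY hZ (mem_antidiagonal.1 ij.2) (show (2 * n - ij.1.2) + ij.1.2 = 2 * n by omega)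
          (show (2 * n - ij.1.2) + 2 * c = ij.1.1 + 2 * n by have := mem_antidiagonal.1 ij.2; omega) (by omega) (by have := mem_antidiagonal.1 ij.2; omega)
          (Φ ij.1.1 ij.1.2 (2 * n - ij.1.2) (((c : ℕ) : ℤ) - ((n : ℕ) : ℤ)) (mem_antidiagonal.1 ij.2) (by omega) (by omega) (by have := mem_antidiagonal.1 ij.2; omega) hj.2)
        exact ⟨t, ht, fun _ _ v ↦ htφ v⟩
      · exact ⟨0, Submodule.zero_mem _, fun hj' hP ↦ absurd ⟨hj', hP⟩ hj⟩
    choose t ht htΦ using key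
    obtain ⟨γ, hγ, hact⟩ := h t ht
    refine ⟨γ, hγ, fun i j a r hij haj hab hr hw hP v ↦ ?_⟩
    obtain rfl : a = 2 * n - j := by omega
    obtain rfl : r = ((c : ℕ) : ℤ) - ((n : ℕ) : ℤ) := by omega
    rw [hact i j (2 * n - j) hij haj hab hP]
    exact htΦ ⟨(i, j), HasAntidiagonal.mem_antidiagonal.2 hij⟩ (show j ≤ 2 * n by omega) hP v
  · intro h t ht
    -- the morphisms `φ_{t_{ij}}` (g31-#2 §1)
    have key : ∀ (i j a : ℕ) (r : ℤ) (hij : i + j = 2 * c) (_haj : a + j = 2 * n) (_hr : ((n : ℕ) : ℤ) + r = ((c : ℕ) : ℤ)) (hw : ((i : ℕ) : ℤ) - 2 * r = ((a : ℕ) : ℤ)), P j →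
        ∃ φ : HodgeStructure.Hom (BettiUniverse.hodge hHD hZ a) (((BettiUniverse.hodge hHD hY i).tateTwist r).cast hw),
          ∀ (hab : a + 2 * c = i + 2 * n) (v : bettiCohomology Z a), ofRatClass (ComplexPoints Y) i (φ.toLinearMap v) =
            corrAction complexOrientationFamily hY hZ hab (ofRatClass (ComplexPoints (Y ⊗ Z)) (2 * c) (BettiUniverse.crossMap Y Z hij (t ⟨(i, j), HasAntidiagonal.mem_antidiagonal.2 hij⟩)))
              (ofRatClass (ComplexPoints Z) a v) := by
      intro i j a r hij haj hr hw _
      obtain ⟨φ, hφ⟩ := BettiUniverse.exists_hom_tateTwist_int_of_mem_hodgeClasses_kunnethSummand hHD hY hZ hij (show a + 2 * c = i + 2 * n by omega) hr hw (ht ⟨(i, j), HasAntidiagonal.mem_antidiagonal.2 hij⟩)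
      exact ⟨φ, fun _ v ↦ hφ v⟩
    choose Φ hΦ using key
    obtain ⟨γ, hγ, hact⟩ := h Φ
    refine ⟨γ, hγ, fun i j a hij haj hab hP ↦ LinearMap.ext_on_range (BettiUniverse.span_range_ofRatClass_eq_top hZ a) fun v ↦ ?_⟩
    have hw : ((i : ℕ) : ℤ) - 2 * (((c : ℕ) : ℤ) - ((n : ℕ) : ℤ)) = ((a : ℕ) : ℤ) := by omega
    rw [hact i j a (((c : ℕ) : ℤ) - ((n : ℕ) : ℤ)) hij haj hab (by omega) hw hP v, hΦ]

/-- **Free complement ⇒ [all Hodge classes of `H^{2c}(Y × Z)` algebraic ⟺ every `P`-family of morphisms of Hodge structures `φ_{ij} : H^{2n−j}(Z) → Hⁱ(Y)(c − n)`, `j ∈ P`, is jointly induced by one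
rational algebraic class of `H^{2c}(Y × Z)`]** (§1 + the previous conversion). [cite: VoisinHodgeI2002, §7.3.1 Def. 7.22, §11.3.3 Thm. 11.38–11.40, Lemma 11.41 and pp. 285–287]
[cite: Voisin2025, §3.2.1 (12)–(14), Prop. 3.8 and Cor. 3.9] [cite: Deligne2000, §1] -/
theorem BettiUniverse.forall_hodgeClasses_algebraic_iff_joint_hom_tateTwist_int (hHD : exists_isReal_hodgeModel) (hY : IsSmoothProjective m Y) (hZ : IsSmoothProjective n Z)
    (hYZ : IsSmoothProjective d (Y ⊗ Z)) {c : ℕ} (P : ℕ → Prop)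
    (hfree : ∀ (i j : ℕ) (hij : i + j = 2 * c), ¬ P j → ∀ u ∈ (BettiUniverse.kunnethSummand hHD hY hZ (2 * c) ⟨(i, j), HasAntidiagonal.mem_antidiagonal.2 hij⟩).hodgeClasses c,
      ofRatClass (ComplexPoints (Y ⊗ Z)) (2 * c) (BettiUniverse.crossMap Y Z hij u) ∈ algebraicClasses (Y ⊗ Z) c) :
    (∀ v ∈ (BettiUniverse.hodge hHD hYZ (2 * c)).hodgeClasses c, ofRatClass (ComplexPoints (Y ⊗ Z)) (2 * c) v ∈ algebraicClasses (Y ⊗ Z) c) ↔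
      ∀ Φ : ∀ (i j a : ℕ) (r : ℤ) (_hij : i + j = 2 * c) (_haj : a + j = 2 * n) (_hr : ((n : ℕ) : ℤ) + r = ((c : ℕ) : ℤ)) (hw : ((i : ℕ) : ℤ) - 2 * r = ((a : ℕ) : ℤ)), P j →
          HodgeStructure.Hom (BettiUniverse.hodge hHD hZ a) (((BettiUniverse.hodge hHD hY i).tateTwist r).cast hw),
        ∃ γ : bettiCohomology (Y ⊗ Z) (2 * c), ofRatClass (ComplexPoints (Y ⊗ Z)) (2 * c) γ ∈ algebraicClasses (Y ⊗ Z) c ∧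
          ∀ (i j a : ℕ) (r : ℤ) (hij : i + j = 2 * c) (haj : a + j = 2 * n) (hab : a + 2 * c = i + 2 * n) (hr : ((n : ℕ) : ℤ) + r = ((c : ℕ) : ℤ)) (hw : ((i : ℕ) : ℤ) - 2 * r = ((a : ℕ) : ℤ))
            (hP : P j), ∀ v, corrAction complexOrientationFamily hY hZ hab (ofRatClass (ComplexPoints (Y ⊗ Z)) (2 * c) γ) (ofRatClass (ComplexPoints Z) a v) =
              ofRatClass (ComplexPoints Y) i ((Φ i j a r hij haj hr hw hP).toLinearMap v) := by
  rw [BettiUniverse.forall_hodgeClasses_algebraic_iff_joint_corrAction complexOrientationFamily hHD hY hZ hYZ P hfree]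
  exact BettiUniverse.joint_corrAction_iff_joint_hom_tateTwist_int hHD hY hZ P

end JointHom

end Literature.AlgebraicGeometry.HodgeTheory

end
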